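import Mathlib
import Summits.KontsevichZagierPeriods.Zeta5Search.ConstantTermFloorWindow
import HarnessLib

/-!
# ζ(5) search — `SingleRowLaw`: the single-pole rows of the `𝒦`-bracket carry the refund (a THEOREM)

Cell `pub-zeta5` (HONEST FRAMING: systematic search; no irrationality claim unless certified), typer seat
generation 9.  Discharges BY NAME gen-2 g8's `SingleRowLaw` (`Zeta5Search/ClusterValuationPairs.lean` §3c; REPORT-gen2-g8 §3.1(a);
exact check there: 20,606 rows + exhaustive n ≤ 13):

* `singleRowLaw_holds : SingleRowLaw` — for a single-pole class `x`,
  `v_p(𝒦_x(b⁺)·V(b) − 𝒦_x(b)·V(b⁺)) ≥ 1 − N_p(b)`.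

PROOF (as on paper): `v(𝒦_x(b)) ≥ 1` (`SinglePoleClassKBound`, typer g8); the class of `x` for `b⁺ = b + e_j` has at most one pole
(`classPoleCount_shift_le`), so `v(𝒦_x(b⁺)) ≥ 1` as well (or `𝒦_x(b⁺) = 0`); THEOREM V (`constantTermFloorLaw_window`, typer g9)
gives `v(V(b)) ≥ −N_p(b)` and `v(V(b⁺)) ≥ −N_p(b⁺) ≥ −N_p(b)` (`pairFloors_shift_le`).  Ultrametric inequality.
`p`-adic norms of rational numbers; nothing about irrationality.
-/

noncomputable section

open Finset

namespace Summit.KontsevichZagierPeriods.Zeta5Search.ClusterValuation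

open Summit.KontsevichZagierPeriods.Zeta5Search.DualSeries (InBox)
open Summit.KontsevichZagierPeriods.Zeta5Search.WedgeDictionary (coeffV)
open Summit.KontsevichZagierPeriods.Zeta5Search.CasoratianValuation (InPolytope pairFloors shift)
open Summit.KontsevichZagierPeriods.Zeta5Search.PadicSeries

variable {p : ℕ} [hp : Fact p.Prime]

/-- `‖V(b)‖_p ≤ p^{N_p(b)}` in the window (norm form of THEOREM V). -/
theorem padicNorm_coeffV_le_pairFloors (b : ℕ → ℤ) (hb : InPolytope b) (hp5 : 5 ≤ p)
    (hwin : (b 0 + 2 : ℤ) < (p : ℤ) ^ 2) : padicNorm p (coeffV b) ≤ (p : ℚ) ^ pairFloors b p := by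
  have h := padicNorm_le_of_val (p := p) (x := coeffV b) (m := -pairFloors b p)
    (fun hV => constantTermFloorLaw_window b p hb hp.out hp5 hwin hV)
  rwa [neg_neg] at h

/-- `‖𝒦_x(b)‖_p ≤ p⁻¹` for a class with at most one pole. -/
theorem padicNorm_classK_le_of_le_one (b : ℕ → ℤ) (hb : InPolytope b) (hp5 : 5 ≤ p)
    (hwin : (b 0 + 2 : ℤ) < (p : ℤ) ^ 2) {x : ℕ} (hx : x < p) (hle : classPoleCount b p x ≤ 1) :
    padicNorm p (classK b p x) ≤ (p : ℚ) ^ (-(1 : ℤ)) := by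
  rcases Nat.eq_zero_or_pos (classPoleCount b p x) with h0 | hpos
  · rw [classK_eq_zero_of_noPole b hb h0, padicNorm.zero]; exact zpow_p_nonneg _
  · exact padicNorm_classK_le_single b hb hp5 hwin hx (by omega)

/-- **`SingleRowLaw` is a theorem.** -/
theorem singleRowLaw_holds : SingleRowLaw := by
  intro b j p x hb hj1 hj7 hb' hprime hp5 hwin hx hone hne
  haveI : Fact p.Prime := ⟨hprime⟩
  have hp1 : (1 : ℚ) < p := by exact_mod_cast hprime.one_lt
  have hwin' : (shift b j 0 + 2 : ℤ) < (p : ℤ) ^ 2 := by rwa [BigPrime.shift_zero b hj1]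
  have hN' : pairFloors (shift b j) p ≤ pairFloors b p := pairFloors_shift_le b hj1 p hprime.pos
  have hK : padicNorm p (classK b p x) ≤ (p : ℚ) ^ (-(1 : ℤ)) :=
    padicNorm_classK_le_of_le_one b hb hp5 hwin hx (by omega)
  have hK' : padicNorm p (classK (shift b j) p x) ≤ (p : ℚ) ^ (-(1 : ℤ)) :=
    padicNorm_classK_le_of_le_one (shift b j) hb' hp5 hwin' hx
      ((classPoleCount_shift_le b hb.1 hj1 p x).trans (by omega))
  have hV : padicNorm p (coeffV b) ≤ (p : ℚ) ^ pairFloors b p := padicNorm_coeffV_le_pairFloors b hb hp5 hwin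
  have hV' : padicNorm p (coeffV (shift b j)) ≤ (p : ℚ) ^ pairFloors b p :=
    (padicNorm_coeffV_le_pairFloors (shift b j) hb' hp5 hwin').trans (zpow_le_zpow_right₀ hp1.le hN')
  apply val_ge_of_padicNorm_le hne
  have e : -(1 - pairFloors b p) = (-(1 : ℤ)) + pairFloors b p := by ring
  rw [e]
  exact (padicNorm.sub (p := p)).trans (max_le (padicNorm_mul_le hK' hV) (padicNorm_mul_le hK hV'))

end Summit.KontsevichZagierPeriods.Zeta5Search.ClusterValuation

end
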